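import Summits.BirchSwinnertonDyer.BirchSwinnertonDyer.Theorems.SchneiderFreeAdditiveX3SemistableTwistLocalThreeKernel
import HarnessLib

/-!
# Route `SchneiderFreeAdditiveX3` (K1 door): the NON-ANOMALOUS CLAUSE at the additive prime of a
# semistable-twist curve FROM THE FROBENIUS OF THE TWIST — `W = V ⊗ χ_{p*}`, `V` good ordinary with
# `a_p(V) ≢ 1 (mod p)`; every odd `p`, NEW AT `p = 3`

Cell `bsd-schneider-ideate`, seat `bsd-schneider-door-c5` (prover, generation 25; assembly layer; `--supports` 19177).
PARTITION: board row B6 ∩ X3 ∩ sst-twist, `r = 1` (7 101 pairs; (G-ord, `e = 2`) half 2 560, of which 2 411 at `p = 3`) of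
`Rank1Residual.partition`; types-the-object-of nothing new; supplies the LOCAL input `hna` of generations 23–24's road
(CGLS 2022 Prop. 14 ⇒ `Λ`-torsion + `μ = 0`; Keller–Yin 2024 Thm. 1.4.1's `λ`-count; the door inequality) at `p = 3` for the
NON-ANOMALOUS pairs (census kit j319291: 686 of the 2 411 (G-ord) pairs at `p = 3`; 1 127 of the 4 383 (M) pairs at `p = 3`);
closes none of B6's cells (BSD NOT advanced). bears_on: K1-door (items 18971/18972 → 19177 r3) + K1-wing (20365).

WHAT.  Generation 23 (`…SemistableTwistLocalNonAnomalous`) proved the clause «no decomposition group above `p` fixes a rational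
line of `W[p]` pointwise or acts trivially on its quotient» for `W = C • V^{(d)}`, `ord_p d = 1`, `V` with an unramified-quotient
line, from INERTIA alone: the Jordan–Hölder characters of `W[p]|_{I_p}` are `ω^{(p+1)/2}, ω^{(p−1)/2}`, both `∉ {1, ω}` once
`p ≥ 5`.  At `p = 3` they ARE `{1, ω}` and inertia cannot decide — but CGLS's hypothesis is about the DECOMPOSITION group:
with `d = p* = (−1)^{(p−1)/2} p` one has `√p* ∈ ℚ(ζ_p)` (Gauss), so for `V` GOOD ORDINARY at `p` with unit-root character `α`
(`α(Frob_p) = a_p(V)`, Serre §1.11 (1)) the decomposition group acts on `W[p]` through `(ω α⁻¹ ε ∗; 0 α ε)`, `ε` the quadratic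
character of `√p*`, and an element `φ ∈ D_𝔓` with `χ̄_p(φ) = 1` (a Frobenius corrected by inertia) fixes `√p*` and acts on the
unramified quotient by `a_p(V)`.  If `a_p(V) ≢ 1 (mod p)` ("`V` NON-ANOMALOUS at `p`", Mazur) the clause follows for every odd `p`:
the one place where the determinant `det ρ̄_{V,p} = χ̄_p` (Weil pairing) has to be used.  At `p = 3` this is exactly the missing
case (`p* = −3`, `ε = ω`: `W[3]|_{D_𝔓} ~ (α⁻¹ ∗; 0 ωα)`), and the hypothesis is sharp: for `a_3(V) ≡ 1 (mod 3)` the line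
`α⁻¹` IS fixed pointwise.

PROOF (pure group theory on the `𝔽_p`-plane over tree theorems).  `K ≤ V[p]` := the kernel of the reduction map on `V[p]`
(`geomReduction`); it is a line (`≠ ⊤`: reduction is non-zero on `V[p]` at an ordinary prime, `exists_zsmul_eq_zero_geomReduction_ne_zero`;
`≠ ⊥`: an inertia element with `χ̄_p = −1` would otherwise act trivially with determinant `−1`), inertia acts trivially on `V[p]/K`
(`geomReduction_smul_of_mem_inertia`), and an arithmetic Frobenius `σ` acts on `V[p]/K` by `a_p` (`geomReduction_smul_eq_frobeniusTrace_smul`);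
`φ := σ·τ` with `τ ∈ I_𝔓`, `χ̄_p(τ) = χ̄_p(σ)⁻¹`.  DET STEP (`intCast_eq_of_smul_eq_self_of_forall_sub_zsmul_mem`): if `φ` fixes a
non-zero `T₀ ∈ K` then, `φ` acting on `V[p]/𝔽_pT₀` by `a_p`, `χ̄_p(φ) = det ρ̄(φ) = a_p`, i.e. `a_p ≡ 1` — excluded.  Transport the
rational line `Φ ≤ W[p]` along the sign-equivariant `e : W[p] ≃ V[p]` (Silverman X.5.4); `σ₁ ∈ I_𝔓` a Kummer element,
`σ₁√p* = −√p*`.  (i) If `D_𝔓` fixed `Φ` pointwise: `σ₁` acts on `e(Φ)` by `−1` and trivially modulo `K`, so `e(Φ) = K`, and `φ`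
fixes `e(P₀) ∈ K ∖ 0` — det step.  (ii) If `D_𝔓` were trivial on `W[p]/Φ`: for `e(Φ) = K`, `−σ₁T − T, σ₁T − T ∈ K` give `2T ∈ K`
for all `T`; for `e(Φ) ≠ K`, `φ y₀ − y₀ ∈ e(Φ) ∩ K = 0` for `y₀ ∈ K ∖ 0` — det step.

* Tools (companion file `…SemistableTwistLocalThreeKernel`, same namespace): §0 the determinant step
  `intCast_eq_of_smul_eq_self_of_forall_sub_zsmul_mem` (`det ρ̄ = χ̄_p` in a frame); §1
  `smul_geomSqrt_pStar_eq_of_modPCyclotomicCharacterZMod_eq_one` (`√p* ∈ ℚ(ζ_p)`, Gauss sum); §2 `exists_kernelLine_frobenius`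
  (the line `K` and the inertia-corrected Frobenius `φ`).
* This file: §3 `not_fix_and_not_quot_of_kernelLine` (abstract local lemma), §4 `not_fix_and_not_quot_of_goodOrd_pStar_twist_of_not_anomalous`
  (every `𝔓 ∣ p`, every rational line; every odd `p`), `…_of_card_eq` (every subgroup of order `p`, given `Red W p`), and the
  (G-ord, `e = 2`) cell `…_of_classX3_of_subGordTwo_of_forall_twist` (hypothesis: every good-ordinary `p*`-twist model is
  non-anomalous — one census-checkable number per pair; 686 / 2 411 pairs at `p = 3`, kit j319291).

HONEST FRAMING: theorems only (no definition, no named fact, no `sorry`); nothing about BSD or a main conjecture is asserted; for the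
ANOMALOUS pairs (`a_p(V) ≡ 1`: 1 725 of 2 411 at `p = 3`) nothing is claimed; «closes rung: none».  References: Serre, Invent. Math. 15
(1972) §1.11 [Serre1972]; Mazur, Invent. Math. 18 (1972) §1 [Mazur1972]; Silverman *AEC* X.5 Cor. 5.4, III.8 [SilvermanAEC2009];
Ireland–Rosen Prop. 6.3.2 [IrelandRosen1990]; CGLS 2022 §1.2 [CastellaGrossiLeeSkinner2022]; generation 23/24 files.
-/

set_option autoImplicit false
set_option linter.dupNamespace false -- the summit namespace `…BirchSwinnertonDyer.BirchSwinnertonDyer.Theorems` (Sub = Summit, D-0017) trips it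

noncomputable section

open scoped Classical NumberField Pointwise Matrix

open WeierstrassCurve NumberField IsDedekindDomain Field Rat.HeightOneSpectrum
  Literature.NumberTheory.EllipticCurves Literature.NumberTheory.GaloisRepresentations
  Literature.NumberTheory.GaloisRepresentations.Serre1972
  Literature.NumberTheory.EllipticCurves.Rank1Residual
  Summit.BirchSwinnertonDyer.Rank1Residual Summit.BirchSwinnertonDyer.Rank1Residual.GaloisImage
  Summit.BirchSwinnertonDyer.Rank1Residual.Additive
  Summit.BirchSwinnertonDyer.BirchSwinnertonDyer.Theorems.SchneiderFreeAdditiveX3.SemistableTwistLocal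

namespace Summit.BirchSwinnertonDyer.BirchSwinnertonDyer.Theorems.SchneiderFreeAdditiveX3.SemistableTwistLocalThree

/-! ### §3 The abstract local lemma -/

section Local

variable {V W : WeierstrassCurve ℚ} [V.IsElliptic] {p : ℕ} [hp : Fact p.Prime]

/-- **Abstract local lemma.**  `W = C • V^{(d)}` with `ord_p d = 1` (`p` odd), `𝔓 ∣ p`, `K ≤ V[p]` a line with `I_𝔓` trivial on
`V[p]/K`, and `φ ∈ D_𝔓` fixing `√d` with `χ̄_p(φ) = 1` and `φ x − a x ∈ K` on `V[p]` for an integer `a ≢ 1 (mod p)`.  Then for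
every rational line `Φ ≤ W[p]`, `D_𝔓` does not fix `Φ` pointwise and does not act trivially on `W[p]/Φ`.  (Proof in the module
docstring: sign-equivariant transport, a Kummer inertia element `σ₁√d = −√d`, and the determinant step §0.)
[cite: Serre1972, §1.11] [cite: SilvermanAEC2009, X.5 Cor. 5.4] -/
theorem not_fix_and_not_quot_of_kernelLine (hp2 : p ≠ 2)
    {d : ℤ} (C : VariableChange ℚ) (hC : C • V.quadraticTwist (d : ℚ) = W)
    {v : HeightOneSpectrum (𝓞 ℚ)} (hpv : ((p : ℕ) : 𝓞 ℚ) ∈ v.asIdeal)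
    (hd : v.intValuation (d : 𝓞 ℚ) = WithZero.exp (-1 : ℤ))
    {𝔓 : Ideal (absIntegers (𝓞 ℚ) ℚ)} (h𝔓 : 𝔓 ∈ v.primesAbove)
    {K : AddSubgroup (geomTorsion V (p : ℤ))} (hK : Nat.card K = p)
    (hKI : ∀ τ ∈ 𝔓.inertia (absoluteGaloisGroup ℚ), ∀ x : geomTorsion V (p : ℤ), τ • x - x ∈ K)
    {φ : absoluteGaloisGroup ℚ} (hφD : φ ∈ 𝔓.decompositionSubgroup (absoluteGaloisGroup ℚ))
    (hφfix : φ • geomSqrt (d : ℚ) = geomSqrt (d : ℚ)) (hφχ : modPCyclotomicCharacterZMod ℚ p φ = 1)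
    {a : ℤ} (hφa : ∀ x : geomTorsion V (p : ℤ), φ • x - a • x ∈ K) (hna : ¬ (p : ℤ) ∣ a - 1)
    {Φ : AddSubgroup (geomTorsion W (p : ℤ))} (hΦ : IsRationalLine W p Φ) :
    (¬ ∀ g ∈ 𝔓.decompositionSubgroup (absoluteGaloisGroup ℚ), ∀ P ∈ Φ, g • P = P) ∧
      (¬ ∀ g ∈ 𝔓.decompositionSubgroup (absoluteGaloisGroup ℚ),
        ∀ P : geomTorsion W (p : ℤ), g • P - P ∈ Φ) := by
  have hpP : p.Prime := hp.out
  have hd0 : (d : ℚ) ≠ 0 := by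
    rintro h
    have hdz : d = 0 := by exact_mod_cast h
    rw [hdz, Int.cast_zero, map_zero] at hd
    exact WithZero.zero_ne_coe hd
  have hID : 𝔓.inertia (absoluteGaloisGroup ℚ) ≤ 𝔓.decompositionSubgroup (absoluteGaloisGroup ℚ) :=
    Ideal.inertia_le_decompositionSubgroup _ _
  -- the sign-equivariant twisting isomorphism `e : W[p] ≃ V[p]`
  have hC' : C⁻¹ • W = V.quadraticTwist (d : ℚ) := by rw [← hC, inv_smul_smul]
  obtain ⟨e, hpos, hneg⟩ := exists_signEquiv_of_twist (W := V) (Wd := W) (p := p) hd0 C⁻¹ hC'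
  -- the transported line `ΦV = e(Φ) ≤ V[p]`
  set ΦV : AddSubgroup (geomTorsion V (p : ℤ)) := Φ.map e.toAddMonoidHom with hΦV
  have hmem : ∀ P, e P ∈ ΦV ↔ P ∈ Φ := fun P ↦ by
    rw [hΦV, AddSubgroup.mem_map_equiv, AddEquiv.symm_apply_apply]
  have hΦVcard : Nat.card ΦV = p :=
    (Nat.card_congr (Φ.equivMapOfInjective e.toAddMonoidHom e.injective).toEquiv).symm.trans hΦ.1
  -- a Kummer inertia element moving `√d`
  have h2v : (2 : 𝓞 ℚ) ∉ v.asIdeal := two_not_mem_of_natCast_prime_mem hpP hp2 hpv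
  obtain ⟨σ₁, hσ₁I, hσ₁⟩ := exists_mem_inertia_smul_geomSqrt_eq_neg (E := ℚ) hd h2v h𝔓
  have hcoe : (((d : 𝓞 ℚ)) : ℚ) = (d : ℚ) := by rw [RingOfIntegers.coe_eq_algebraMap, map_intCast]
  rw [hcoe] at hσ₁
  have hσ₁ne : ¬ σ₁ • geomSqrt (d : ℚ) = geomSqrt (d : ℚ) := by
    rw [hσ₁]
    intro h
    exact geomSqrt_ne_zero hd0 (neg_eq_self.mp h)
  -- THE DETERMINANT STEP: `φ` fixes no non-zero point of `K`
  have hdet : ∀ T₀ : geomTorsion V (p : ℤ), T₀ ≠ 0 → T₀ ∈ K → φ • T₀ = T₀ → False := by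
    intro T₀ hT₀ hT₀K hfixT
    -- `K = ℤ T₀`
    have hKeq : AddSubgroup.zmultiples T₀ = K := by
      have hle : AddSubgroup.zmultiples T₀ ≤ K := (AddSubgroup.zmultiples_le_of_mem hT₀K)
      have hpT₀ : p • T₀ = 0 := by
        rw [← natCast_zsmul]
        exact Subtype.ext ((Submodule.mem_torsionBy_iff _ _).mp T₀.2)
      have hcard : Nat.card (AddSubgroup.zmultiples T₀) = p := by
        rw [Nat.card_zmultiples, addOrderOf_eq_prime hpT₀ hT₀]
      haveI : Finite K := Nat.finite_of_card_ne_zero (by rw [hK]; exact hpP.ne_zero)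
      exact AddSubgroup.eq_of_le_of_card_ge hle (by rw [hK, hcard])
    have h1 := intCast_eq_of_smul_eq_self_of_forall_sub_zsmul_mem V p hT₀ hfixT (a := a)
      (fun x ↦ hKeq ▸ hφa x)
    rw [hφχ, Units.val_one] at h1
    apply hna
    rw [← ZMod.intCast_zmod_eq_zero_iff_dvd, Int.cast_sub, Int.cast_one, ← h1, sub_self]
  -- a non-zero point of `Φ`
  obtain ⟨P₀, hP₀Φ, hP₀⟩ := exists_mem_ne_zero_of_natCard_eq hΦ.1
  have hx₀ : e P₀ ≠ 0 := (AddEquiv.map_ne_zero_iff e).mpr hP₀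
  have hx₀Φ : e P₀ ∈ ΦV := (hmem P₀).mpr hP₀Φ
  refine ⟨fun hfix ↦ ?_, fun hquot ↦ ?_⟩
  · -- (i) `D_𝔓` does not fix `Φ` pointwise
    -- `σ₁` acts on `e P₀` by `-1` and trivially modulo `K`: `e P₀ ∈ K`
    have h1 : σ₁ • P₀ = P₀ := hfix _ (hID hσ₁I) P₀ hP₀Φ
    have h2 : σ₁ • e P₀ = -e P₀ := by
      have h := hneg _ hσ₁ne P₀
      rw [h1] at h
      exact (neg_eq_iff_eq_neg.mpr h).symm
    have h3 : e P₀ ∈ K := by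
      have h := hKI σ₁ hσ₁I (e P₀)
      rw [h2, show -e P₀ - e P₀ = -((2 : ℤ) • e P₀) by rw [two_zsmul]; abel] at h
      exact mem_of_two_zsmul_mem hp2 ((neg_mem_iff).mp h)
    -- `φ` fixes `P₀`, hence `e P₀`
    have h4 : φ • e P₀ = e P₀ := by rw [← hpos _ hφfix, hfix _ hφD P₀ hP₀Φ]
    exact hdet (e P₀) hx₀ h3 h4
  · -- (2) `D_𝔓` does not act trivially on `W[p]/Φ`
    have hquotV : ∀ g ∈ 𝔓.decompositionSubgroup (absoluteGaloisGroup ℚ), ∀ T : geomTorsion V (p : ℤ),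
        e (g • e.symm T) - T ∈ ΦV := by
      intro g hg T
      have h := hquot g hg (e.symm T)
      rw [← hmem, map_sub, e.apply_symm_apply] at h
      exact h
    rcases line_eq_or_inf_eq_bot hΦVcard hK with heq | hinf
    · -- `e(Φ) = K`: with `σ₁`, `−σ₁T − T ∈ K` and `σ₁T − T ∈ K`, so `2T ∈ K` for all `T`: `K = V[p]`
      obtain ⟨Q₀, hQ₀⟩ := exists_not_mem_of_natCard_eq hK
      apply hQ₀
      have h1 : e (σ₁ • e.symm Q₀) - Q₀ ∈ K := heq ▸ hquotV σ₁ (hID hσ₁I) Q₀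
      rw [hneg _ hσ₁ne, e.apply_symm_apply] at h1
      have h2 : σ₁ • Q₀ - Q₀ ∈ K := hKI σ₁ hσ₁I Q₀
      have h3 : -(σ₁ • Q₀) - Q₀ + (σ₁ • Q₀ - Q₀) = -((2 : ℤ) • Q₀) := by
        rw [two_zsmul]; abel
      have h4 : -((2 : ℤ) • Q₀) ∈ K := h3 ▸ K.add_mem h1 h2
      exact mem_of_two_zsmul_mem hp2 ((neg_mem_iff).mp h4)
    · -- `e(Φ) ≠ K`: `φ y₀ − y₀ ∈ e(Φ) ∩ K = 0` for `y₀ ∈ K ∖ 0`, so `φ` fixes `y₀` — determinant step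
      obtain ⟨y₀, hy₀K, hy₀⟩ := exists_mem_ne_zero_of_natCard_eq hK
      have h1 : e (φ • e.symm y₀) - y₀ ∈ ΦV := hquotV φ hφD y₀
      rw [hpos _ hφfix, e.apply_symm_apply] at h1
      have h2 : φ • y₀ - y₀ ∈ K := by
        have h := K.add_mem (hφa y₀) (K.sub_mem (K.zsmul_mem hy₀K a) hy₀K)
        rwa [sub_add_sub_cancel] at h
      have h3 : φ • y₀ - y₀ ∈ ΦV ⊓ K := ⟨h1, h2⟩
      rw [hinf, AddSubgroup.mem_bot, sub_eq_zero] at h3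
      exact hdet y₀ hy₀ hy₀K h3

end Local

/-! ### §4 The good-ordinary `p*`-twist (every `𝔓 ∣ p`), every line, the (G-ord, `e = 2`) cell -/

section Classes

variable {V W : WeierstrassCurve ℚ} [V.IsElliptic] [V.IsGloballyMinimal] (p : ℕ) [hp : Fact p.Prime]

/-- **(G-ord, `e = 2`) shape from a NON-ANOMALOUS twist, every prime above `p`, every odd `p`.**  `V/ℚ` globally minimal GOOD
ORDINARY at `p` with `a_p(V) ≢ 1 (mod p)`, `W = C • V^{(p*)}`: for every `𝔓 ∣ p` and every rational line `Φ ≤ W[p]`, `D_𝔓`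
neither fixes `Φ` pointwise nor acts trivially on `W[p]/Φ`.  (§2 at the place's prime, §1 for `φ√p* = √p*`, §3, and
conjugation `D_{σ𝔓} = σ D_𝔓 σ⁻¹` to every `𝔓`, generation 23's `not_fix_and_not_quot_smul`.)  New at `p = 3`; at `p ≥ 5`
generation 23's `not_fix_and_not_quot_of_goodOrd_pStar_twist` needs no hypothesis on `a_p`.
[cite: Serre1972, §1.11 (1) and Prop. 11] [cite: SilvermanAEC2009, X.5 Cor. 5.4] [cite: Mazur1972, §1] -/
theorem not_fix_and_not_quot_of_goodOrd_pStar_twist_of_not_anomalous (hp2 : p ≠ 2) (hV : GoodOrd V p)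
    (hna : ¬ (p : ℤ) ∣ V.frobeniusTrace p - 1)
    (C : VariableChange ℚ) (hC : C • V.quadraticTwist ((-1 : ℚ) ^ (p / 2) * p) = W)
    {v : HeightOneSpectrum (𝓞 ℚ)} (hpv : ((p : ℕ) : 𝓞 ℚ) ∈ v.asIdeal)
    {𝔓 : Ideal (absIntegers (𝓞 ℚ) ℚ)} (h𝔓 : 𝔓 ∈ v.primesAbove)
    {Φ : AddSubgroup (geomTorsion W (p : ℤ))} (hΦ : IsRationalLine W p Φ) :
    (¬ ∀ g ∈ 𝔓.decompositionSubgroup (absoluteGaloisGroup ℚ), ∀ P ∈ Φ, g • P = P) ∧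
      (¬ ∀ g ∈ 𝔓.decompositionSubgroup (absoluteGaloisGroup ℚ),
        ∀ P : geomTorsion W (p : ℤ), g • P - P ∈ Φ) := by
  obtain ⟨𝔓₀, h𝔓₀, K, hK, hKI, φ, hφD, hφχ, hφa⟩ := exists_kernelLine_frobenius hp2 hV hpv
  have hφfix := smul_geomSqrt_pStar_eq_of_modPCyclotomicCharacterZMod_eq_one p hp2 hφχ
  rw [← pStar_cast p] at hC hφfix
  have h₀ := not_fix_and_not_quot_of_kernelLine hp2 C hC hpv (intValuation_pStar p hpv) h𝔓₀ hK hKI hφD hφfix hφχ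
    hφa hna hΦ
  obtain ⟨σ, hσ⟩ := IsDedekindDomain.HeightOneSpectrum.exists_smul_eq_of_mem_primesAbove_holds h𝔓₀ h𝔓
  rw [← hσ]
  exact not_fix_and_not_quot_smul hΦ σ h₀

variable (W) [W.IsElliptic]

/-- **Every subgroup of order `p` (no stability assumed), given that `W[p]` is reducible** (`Red W p`, so that a rational line
exists): the rational-line clause above transferred by generation 24's `not_fix_and_not_quot_of_red_of_forall_isRationalLine`
(two distinct lines of the plane are complementary). [cite: Serre1972, §1.11] [cite: SilvermanAEC2009, X.5 Cor. 5.4] -/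
theorem not_fix_and_not_quot_of_goodOrd_pStar_twist_of_not_anomalous_of_card_eq (hp2 : p ≠ 2) (hV : GoodOrd V p)
    (hna : ¬ (p : ℤ) ∣ V.frobeniusTrace p - 1)
    (C : VariableChange ℚ) (hC : C • V.quadraticTwist ((-1 : ℚ) ^ (p / 2) * p) = W) (hred : Red W p)
    {v : HeightOneSpectrum (𝓞 ℚ)} (hpv : ((p : ℕ) : 𝓞 ℚ) ∈ v.asIdeal)
    {𝔓 : Ideal (absIntegers (𝓞 ℚ) ℚ)} (h𝔓 : 𝔓 ∈ v.primesAbove)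
    {Φ : AddSubgroup (geomTorsion W (p : ℤ))} (hΦ : Nat.card Φ = p) :
    (¬ ∀ g ∈ 𝔓.decompositionSubgroup (absoluteGaloisGroup ℚ), ∀ P ∈ Φ, g • P = P) ∧
      (¬ ∀ g ∈ 𝔓.decompositionSubgroup (absoluteGaloisGroup ℚ),
        ∀ P : geomTorsion W (p : ℤ), g • P - P ∈ Φ) :=
  SemistableTwistLocalAnyLine.not_fix_and_not_quot_of_red_of_forall_isRationalLine hred _
    (fun _ hΦ₀ ↦ not_fix_and_not_quot_of_goodOrd_pStar_twist_of_not_anomalous p hp2 hV hna C hC hpv h𝔓 hΦ₀) hΦ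

variable [W.IsGloballyMinimal]

/-- **The (G-ord, `e = 2`) cell of B6 ∩ X3 under the NON-ANOMALOUS-TWIST clause, every odd `p` (new at `p = 3`), every
`𝔓 ∣ p`, every subgroup of order `p` of `W[p]`.**  `ClassX3 W p ∧ SubGordTwo W p` has good-ordinary `p*`-twist models
`W = C • V^{(p*)}` (`ClassX3Gord.exists_goodOrd_pStar_twist_model`); the hypothesis asks EVERY such model to be non-anomalous
(`a_p(V) ≢ 1 (mod p)`; they are all `ℚ`-isomorphic, so this is one census-checkable number per pair: kit j319291 — 686 of the
2 411 pairs of the cell at `p = 3`).  This is the `hna` input of generations 23–24's `_of_nonAnomalous` theorems.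
[cite: Serre1972, §1.11] [cite: SilvermanAEC2009, X.5 Cor. 5.4] [cite: CastellaGrossiLeeSkinner2022, §1.2 (hypothesis θ|_{G_v̄} ≠ 𝟙, ω)] -/
theorem not_fix_and_not_quot_of_classX3_of_subGordTwo_of_forall_twist (hp2 : p ≠ 2) (hX : ClassX3 W p)
    (hSG : SubGordTwo W p)
    (hna : ∀ (V : WeierstrassCurve ℚ) [V.IsElliptic] [V.IsGloballyMinimal] (C : VariableChange ℚ),
      GoodOrd V p → C • V.quadraticTwist ((-1 : ℚ) ^ (p / 2) * p) = W → ¬ (p : ℤ) ∣ V.frobeniusTrace p - 1)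
    {v : HeightOneSpectrum (𝓞 ℚ)} (hpv : ((p : ℕ) : 𝓞 ℚ) ∈ v.asIdeal)
    {𝔓 : Ideal (absIntegers (𝓞 ℚ) ℚ)} (h𝔓 : 𝔓 ∈ v.primesAbove)
    {Φ : AddSubgroup (geomTorsion W (p : ℤ))} (hΦ : Nat.card Φ = p) :
    (¬ ∀ g ∈ 𝔓.decompositionSubgroup (absoluteGaloisGroup ℚ), ∀ P ∈ Φ, g • P = P) ∧
      (¬ ∀ g ∈ 𝔓.decompositionSubgroup (absoluteGaloisGroup ℚ),
        ∀ P : geomTorsion W (p : ℤ), g • P - P ∈ Φ) := by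
  have hXG : ClassX3Gord W p := (classX3Gord_iff_subGord W p hp2 hX).mpr hSG.1
  obtain ⟨V, _, _, C, hV, hC⟩ := ClassX3Gord.exists_goodOrd_pStar_twist_model W p hp2 hXG hSG.2
  exact not_fix_and_not_quot_of_goodOrd_pStar_twist_of_not_anomalous_of_card_eq W p hp2 hV (hna V C hV hC) C hC hX.1
    hpv h𝔓 hΦ

end Classes


end Summit.BirchSwinnertonDyer.BirchSwinnertonDyer.Theorems.SchneiderFreeAdditiveX3.SemistableTwistLocalThree

end
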